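import Mathlib
import Literature.NumberTheory.LFunctions.Zhang2022.Section15Bcoef
import HarnessLib

/-!
# Zhang (2022) §15: the support of `b` reaches only `P₄/T`, so the inline "`P₄/d > T`" of p. 85 holds
# wherever (15.17) uses (15.15) (theorems only)

Topic `Literature/NumberTheory/LFunctions/Zhang2022` (Landau–Siegel audit tree; verdict-neutral).
Y. Zhang, *Discrete mean estimates and the Landau–Siegel zero*, arXiv:2211.02515v1 (2022)
[Zhang2022LandauSiegel] — an unrefereed manuscript under adjudication; nothing here asserts or denies
its Theorems 1–2. Lane ZHANG-L, WP15 (leaf `h15_17 : Typed.Section15B.Eq15_17 c′ bChi`, (15.17) ⇐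
(15.11) + (15.15)); GAP row G-L4t2-1 of the siegel-zhang cell: the printed lead-in of (15.15) (§15 p. 85,
tex L4217) "Assume `dl < PT⁻²`, and `(dl,D) = 1`. Note that `P₄/d > T`." does not follow from
`dl < PT⁻²` (`P₄ = PT⁻²t₀` gives only `P₄/d > t₀l`; typed AS PRINTED `Typed.Section15B.Inline15_P4d`),
while the Lemma-8.4-type contour shift behind (15.15) needs the length `P₄/d > T`. PROVED HERE: the
coefficients `b = u ⋆ v` of (15.1) (`Skeleton.bcoef`; `u` supported on `n < P^{1/2}`, `v` on
`n < max(P₂,P₃)`, `P₂ = P^{1/2}T⁻¹⁰`, `P₃ = P^{0.498}`) vanish for `n ≥ P^{1/2}max(P₂,P₃)`, and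
`P^{1/2}max(P₂,P₃) ≤ P₄/T = Pt₀T⁻³` once `𝓛 ≥ 3` — so `b(n) = 0` for `n ≥ P₄/T`
(`bcoef_eq_zero_of_P4_div_bigT_le`, sharper than the printed (15.2) threshold `PT⁻²η₊` of
`bcoef_eq_zero_of_le`), and for every `(d,l)` with `b(dl) ≠ 0`, `l ≥ 1`: `T < P₄/d`
(`bigT_lt_P4_div_of_bcoef_ne_zero`). Hence (15.15) is only ever CONSUMED where the inline remark is
true; the support reading `Typed.Section15B.Eq15_15S` (statement file `TypedSection15BSubsteps`)
carries `T < P₄/d` as a hypothesis. The private support lemmas of `Section15Bcoef` are re-derived at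
the sharper threshold. WHAT THIS IS NOT: a proof of (15.15) or (15.17), nor any claim about
Theorems 1–2 of the manuscript or Landau–Siegel zeros.

## References
* Y. Zhang, arXiv:2211.02515v1 (2022), §15 p. 85 (tex L4217), (15.1)–(15.2) p. 79; §8 (8.6); §6 p. 12
  (`P₄`); §2 (2.21). [cite: Zhang2022LandauSiegel, §15 p. 85]
-/

noncomputable section

open Complex Real ComplexConjugate

/-! ## The support of `b` reaches only `P₄/T` -/

namespace Literature.NumberTheory.LFunctions.Zhang2022.Skeleton

section Support

variable {D : ℕ}

/-- `ϰ₂(n) = 0` for `n ≥ P₂`. [cite: Zhang2022LandauSiegel, §8 (8.6)] -/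
private theorem vk2_eq_zero_of_P2_le {n : ℕ} (h : P2 D ≤ n) : vk2 D n = 0 := by
  rw [vk2, if_neg (not_lt.mpr h)]

/-- `ϰ₃(n) = 0` for `n ≥ P₃`. [cite: Zhang2022LandauSiegel, §8 (8.6)] -/
private theorem vk3_eq_zero_of_P3_le {n : ℕ} (h : P3 D ≤ n) : vk3 D n = 0 := by
  rw [vk3, if_neg (not_lt.mpr h)]

/-- `P₂ ≤ P^{1/2}` (`P₂ = P^{1/2}T⁻¹⁰`). [cite: Zhang2022LandauSiegel, §2 (2.21)] -/
private theorem P2_le_sqrtP' : P2 D ≤ bigP D ^ (1 / 2 : ℝ) := by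
  have hT : 1 ≤ bigT D ^ 10 :=
    one_le_pow₀ (Real.one_le_exp (Real.rpow_nonneg (Real.log_natCast_nonneg D) _))
  have h0 : 0 ≤ bigP D ^ (1 / 2 : ℝ) := Real.rpow_nonneg (Real.exp_pos _).le _
  rw [P2, show (0.5 : ℝ) = 1 / 2 by norm_num]
  exact div_le_self h0 hT

/-- `u(a) = 0` for `a ≥ P^{1/2}` (the first convolution factor of `b`). [cite: Zhang2022LandauSiegel, §15 (15.2)] -/
private theorem ucoef_eq_zero' {a : ℕ} (ha : bigP D ^ (1 / 2 : ℝ) ≤ a) :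
    (if (a : ℝ) < bigP D ^ (1 / 2 : ℝ) then vk1 D a else 0) + iota2 * vk2 D a = 0 := by
  rw [if_neg (not_lt.mpr ha), vk2_eq_zero_of_P2_le (le_trans P2_le_sqrtP' ha)]
  simp

/-- `v(b) = 0` for `b ≥ max(P₂,P₃)` (the second convolution factor of `b`). [cite: Zhang2022LandauSiegel, §15 (15.2)] -/
private theorem vcoef_eq_zero' {b : ℕ} (hb : max (P2 D) (P3 D) ≤ b) :
    conj iota3 * vk3 D b + conj iota4 * vk2 D b = 0 := by
  rw [vk3_eq_zero_of_P3_le (le_trans (le_max_right _ _) hb),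
    vk2_eq_zero_of_P2_le (le_trans (le_max_left _ _) hb)]
  simp

/-- **`P^{1/2}·max(P₂,P₃) ≤ P₄/T = Pt₀T⁻³` once `𝓛 ≥ 3`** (`P^{1/2}P₂ = PT⁻¹⁰ ≤ Pt₀T⁻³` as `t₀T⁷ ≥ 1`;
`P^{1/2}P₃ = P^{0.998} ≤ Pt₀T⁻³` as `T³ ≤ P^{0.002}` iff `3𝓛^{1.1} ≤ 0.002𝓛⁹`, and `t₀ ≥ 1`).
[cite: Zhang2022LandauSiegel, §15 (15.2); §6 p. 12] -/
theorem sqrtP_mul_max_P2_P3_le_P4_div_bigT (hD : 3 ≤ ell D) :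
    bigP D ^ (1 / 2 : ℝ) * max (P2 D) (P3 D) ≤ P4 D / bigT D := by
  have hℓ0 : 0 < ell D := by linarith
  have hℓ1 : 1 ≤ ell D := by linarith
  have hP : 0 < bigP D := Real.exp_pos _
  have hT1 : 1 ≤ bigT D := Real.one_le_exp (by positivity)
  have hT0 : 0 < bigT D := by linarith
  have ht1 : 1 ≤ t0 D := by rw [t0]; exact one_le_pow₀ hℓ1
  have hsqrt : bigP D ^ (1 / 2 : ℝ) * bigP D ^ (1 / 2 : ℝ) = bigP D := by
    rw [← Real.rpow_add hP]; norm_num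
  have hP4T : P4 D / bigT D = bigP D * t0 D / bigT D ^ 3 := by
    rw [P4]; field_simp
  rw [hP4T, le_div_iff₀ (pow_pos hT0 3)]
  rcases le_total (P3 D) (P2 D) with h32 | h23
  · -- `P^{1/2}·P₂·T³ = P·T⁻¹⁰·T³ ≤ P ≤ P·t₀`
    rw [max_eq_left h32, P2, show (0.5 : ℝ) = 1 / 2 by norm_num]
    have hT7 : bigT D ^ 3 ≤ bigT D ^ 10 := pow_le_pow_right₀ hT1 (by norm_num)
    calc bigP D ^ (1 / 2 : ℝ) * (bigP D ^ (1 / 2 : ℝ) / bigT D ^ 10) * bigT D ^ 3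
        = (bigP D ^ (1 / 2 : ℝ) * bigP D ^ (1 / 2 : ℝ)) * (bigT D ^ 3 / bigT D ^ 10) := by ring
      _ = bigP D * (bigT D ^ 3 / bigT D ^ 10) := by rw [hsqrt]
      _ ≤ bigP D * 1 := by
          gcongr
          exact (div_le_one (pow_pos hT0 10)).mpr hT7
      _ ≤ bigP D * t0 D := by gcongr
  · rw [max_eq_right h23, P3, ← Real.rpow_add hP]
    have hT3 : bigT D ^ 3 = Real.exp (3 * ell D ^ (1.1 : ℝ)) := by
      rw [bigT, ← Real.exp_nat_mul]; norm_num
    have h1 : ell D ^ (1.1 : ℝ) ≤ ell D ^ 2 := by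
      have := Real.rpow_le_rpow_of_exponent_le (x := ell D) hℓ1 (show (1.1 : ℝ) ≤ 2 by norm_num)
      rwa [Real.rpow_two] at this
    have h3 : 1500 * ell D ^ 2 ≤ ell D ^ 9 := by
      have h27 : (27 : ℝ) ≤ ell D ^ 3 := by nlinarith
      have h81 : (81 : ℝ) ≤ ell D ^ 4 := by nlinarith
      have : ell D ^ 9 = ell D ^ 2 * (ell D ^ 3 * ell D ^ 4) := by ring
      rw [this]
      have : (1500 : ℝ) ≤ ell D ^ 3 * ell D ^ 4 := by nlinarith
      nlinarith
    have key : bigT D ^ 3 ≤ bigP D ^ (0.002 : ℝ) := by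
      rw [hT3, bigP, ← Real.exp_mul, Real.exp_le_exp]
      linarith
    calc bigP D ^ (1 / 2 + 0.498 : ℝ) * bigT D ^ 3
        ≤ bigP D ^ (1 / 2 + 0.498 : ℝ) * bigP D ^ (0.002 : ℝ) :=
          mul_le_mul_of_nonneg_left key (by positivity)
      _ = bigP D := by rw [← Real.rpow_add hP]; norm_num
      _ = bigP D * 1 := (mul_one _).symm
      _ ≤ bigP D * t0 D := by gcongr

/-- **The support of `b` reaches only `P₄/T`: `b(n) = 0` for `n ≥ P₄/T`** (`𝓛 ≥ 3`; sharper than the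
printed/typed (15.2) threshold `PT⁻²η₊`, `bcoef_eq_zero_of_le`). [cite: Zhang2022LandauSiegel, §15 (15.2) p. 79] -/
theorem bcoef_eq_zero_of_P4_div_bigT_le (hD : 3 ≤ ell D) {n : ℕ} (hn : P4 D / bigT D ≤ n) :
    bcoef D n = 0 := by
  rw [bcoef]
  refine Finset.sum_eq_zero fun q hq => ?_
  by_contra hne
  have hu := left_ne_zero_of_mul hne
  have hv := right_ne_zero_of_mul hne
  have ha : (q.1 : ℝ) < bigP D ^ (1 / 2 : ℝ) := by
    by_contra h; rw [not_lt] at h; exact hu (ucoef_eq_zero' h)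
  have hb : (q.2 : ℝ) < max (P2 D) (P3 D) := by
    by_contra h; rw [not_lt] at h; exact hv (vcoef_eq_zero' h)
  have hqn : (q.1 : ℝ) * q.2 = n := by
    have := (Nat.mem_divisorsAntidiagonal.mp hq).1
    exact_mod_cast this
  have hlt : (n : ℝ) < bigP D ^ (1 / 2 : ℝ) * max (P2 D) (P3 D) := by
    rw [← hqn]
    exact mul_lt_mul'' ha hb (Nat.cast_nonneg _) (Nat.cast_nonneg _)
  linarith [sqrtP_mul_max_P2_P3_le_P4_div_bigT hD]

/-- **The inline remark "`P₄/d > T`" ON THE SUPPORT** (§15 p. 85, tex L4217): if `b(dl) ≠ 0` and `l ≥ 1`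
then `T < P₄/d` (indeed `dl < P₄/T`; `𝓛 ≥ 3`). This is the true content behind the printed
"Note that `P₄/d > T`" (which does not follow from `dl < PT⁻²`, `Typed.Section15B.Inline15_P4d`).
[cite: Zhang2022LandauSiegel, §15 p. 85] -/
theorem bigT_lt_P4_div_of_bcoef_ne_zero (hD : 3 ≤ ell D) {d l : ℕ} (hl : 1 ≤ l)
    (h : bcoef D (d * l) ≠ 0) : bigT D < P4 D / d := by
  have hT0 : 0 < bigT D := Real.exp_pos _
  have hdl : ((d * l : ℕ) : ℝ) < P4 D / bigT D := by
    by_contra hle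
    exact h (bcoef_eq_zero_of_P4_div_bigT_le hD (not_lt.mp hle))
  have hd0 : d ≠ 0 := by
    rintro rfl
    apply h
    simp [bcoef]
  have hd : (0 : ℝ) < d := by exact_mod_cast Nat.pos_of_ne_zero hd0
  have hdle : (d : ℝ) ≤ ((d * l : ℕ) : ℝ) := by
    have : d ≤ d * l := Nat.le_mul_of_pos_right d hl
    exact_mod_cast this
  rw [lt_div_iff₀ hd]
  calc bigT D * d ≤ bigT D * ((d * l : ℕ) : ℝ) := by gcongr
    _ < bigT D * (P4 D / bigT D) := by gcongr
    _ = P4 D := by field_simp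

end Support

end Literature.NumberTheory.LFunctions.Zhang2022.Skeleton

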